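import Summits.AtomisticToContinuum.HydrodynamicLimit.Theorems.EquilibriumClampedCollisionalWindowLD.Negative.PulseParams

/-!
# Base parameters of the witness and their bounds, part 1 (helper file of the refutation of `EquilibriumClampedCollisionalWindowLD`, stmt-AtomisticToContinuum-13733; see `Cruxes/EquilibriumClampedCollisionalWindowLD/Disproof.lean` and the evidence WITNESS.md; no Theses declaration is asserted positively; refuter-cdisprove-stmt-AtomisticToContinuum-13733-0)
-/

noncomputable section

open Real
open scoped InnerProductSpace

namespace Summit.AtomisticToContinuum.HydrodynamicLimit.Theorems

namespace EquilibriumClampedCollisionalWindowLDNegative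

/-! ### Base parameters of the witness (unit slot spacing; `t = τ^{1/4}`) -/

section BasePar

/-- The block constants of the witness at slot spacing `1`: diameter `4/5`, pulse speed `t³`,
tolerances `t^{-32}, t^{-40}`, horizon `2 t⁴ l²` (twice the window), `αs = 100 t^{-32}`,
`K = 6 t⁷ l² + 2`. [folklore] -/
def bpar (l t : ℕ) : Params :=
  { s := 1, ε := 4 / 5, V := (t : ℝ) ^ 3, r := (4 / 5) / (t : ℝ) ^ 32, u := (4 / 5) / (t : ℝ) ^ 40,
    Tmax := 2 * (t : ℝ) ^ 4 * (l : ℝ) ^ 2, αs := 100 / (t : ℝ) ^ 32, K := 6 * t ^ 7 * l ^ 2 + 2 }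

namespace bpar

section defs
variable (l t : ℕ)
/-- `s_eq` (technical, see the section header). [folklore] -/
@[simp] theorem s_eq : (bpar l t).s = 1 := rfl
/-- `ε_eq` (technical, see the section header). [folklore] -/
@[simp] theorem ε_eq : (bpar l t).ε = 4 / 5 := rfl
/-- `V_eq` (technical, see the section header). [folklore] -/
@[simp] theorem V_eq : (bpar l t).V = (t : ℝ) ^ 3 := rfl
/-- `r_eq` (technical, see the section header). [folklore] -/
@[simp] theorem r_eq : (bpar l t).r = (4 / 5) / (t : ℝ) ^ 32 := rfl
/-- `u_eq` (technical, see the section header). [folklore] -/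
@[simp] theorem u_eq : (bpar l t).u = (4 / 5) / (t : ℝ) ^ 40 := rfl
/-- `T_eq` (technical, see the section header). [folklore] -/
@[simp] theorem T_eq : (bpar l t).Tmax = 2 * (t : ℝ) ^ 4 * (l : ℝ) ^ 2 := rfl
/-- `αs_eq` (technical, see the section header). [folklore] -/
@[simp] theorem αs_eq : (bpar l t).αs = 100 / (t : ℝ) ^ 32 := rfl
/-- `K_eq` (technical, see the section header). [folklore] -/
@[simp] theorem K_eq : (bpar l t).K = 6 * t ^ 7 * l ^ 2 + 2 := rfl
/-- `K_cast` (technical, see the section header). [folklore] -/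
theorem K_cast : ((bpar l t).K : ℝ) = 6 * (t : ℝ) ^ 7 * (l : ℝ) ^ 2 + 2 := by simp [K_eq]
/-- `g_eq` (technical, see the section header). [folklore] -/
@[simp] theorem g_eq : (bpar l t).g = 1 / 5 := by rw [Params.g, s_eq, ε_eq]; norm_num
end defs

/-! Generic manipulation of `C / T^k` bounds (`T ≥ 1`). -/
section generic
variable {T : ℝ} (hT : 1 ≤ T)
include hT

/-- `gpos` (technical, see the section header). [folklore] -/
theorem gpos : 0 < T := lt_of_lt_of_le one_pos hT

/-- Monotonicity of `a / T^k` in `a ≥ 0` and antitonicity in `k`. -/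
theorem dle {a b : ℝ} {j k : ℕ} (ha : 0 ≤ a) (hab : a ≤ b) (hjk : j ≤ k) : a / T ^ k ≤ b / T ^ j := by
  have hp : 0 < T ^ j := pow_pos (gpos hT) j
  calc a / T ^ k ≤ a / T ^ j := div_le_div_of_nonneg_left ha hp (pow_le_pow_right₀ hT hjk)
    _ ≤ b / T ^ j := div_le_div_of_nonneg_right hab hp.le

omit hT in
/-- `dmul` (technical, see the section header). [folklore] -/
theorem dmul (a b : ℝ) (j k : ℕ) : a / T ^ j * (b / T ^ k) = a * b / T ^ (j + k) := by
  rw [div_mul_div_comm, ← pow_add]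

omit hT in
/-- `dadd` (technical, see the section header). [folklore] -/
theorem dadd (a b : ℝ) (k : ℕ) : a / T ^ k + b / T ^ k = (a + b) / T ^ k := (add_div a b _).symm

/-- `T^i · (a / T^(i+k)) = a / T^k`. -/
theorem pmul (a : ℝ) (i k : ℕ) : T ^ i * (a / T ^ (i + k)) = a / T ^ k := by
  have hTi : T ^ i ≠ 0 := (pow_pos (gpos hT) i).ne'
  rw [pow_add]; field_simp

/-- A bound `a / T^k ≤ c` from `a ≤ c` (`a ≥ 0`... not needed: from `a ≤ c T^k`). -/
theorem dle_const {a c : ℝ} {k : ℕ} (hc : 0 ≤ c) (h : a ≤ c) : a / T ^ k ≤ c := by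
  have hp : 1 ≤ T ^ k := one_le_pow₀ hT
  have hp0 : 0 < T ^ k := by positivity
  rw [div_le_iff₀ hp0]; nlinarith

end generic

variable {l t : ℕ} (hl : 2 ≤ l) (ht : 24 * l ^ 2 ≤ t)
include hl ht

/-- `T96` (technical, see the section header). [folklore] -/
theorem T96 : (96 : ℝ) ≤ t := by
  have : 96 ≤ t := le_trans (by nlinarith) ht
  exact_mod_cast this
/-- `T1` (technical, see the section header). [folklore] -/
theorem T1 : (1 : ℝ) ≤ t := le_trans (by norm_num) (T96 hl ht)
/-- `Tpos` (technical, see the section header). [folklore] -/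
theorem Tpos : (0 : ℝ) < t := lt_of_lt_of_le (by norm_num) (T96 hl ht)
omit ht in
/-- `L2` (technical, see the section header). [folklore] -/
theorem L2 : (2 : ℝ) ≤ l := by exact_mod_cast hl
omit hl in
/-- `TL` (technical, see the section header). [folklore] -/
theorem TL : 24 * (l : ℝ) ^ 2 ≤ t := by exact_mod_cast ht
omit hl in
/-- `L2_le` (technical, see the section header). [folklore] -/
theorem L2_le : (l : ℝ) ^ 2 ≤ t / 24 := by have := TL ht; linarith

/-- `1/t^k ≤ 1/96` for `k ≥ 1`. -/
theorem small {k : ℕ} (hk : 1 ≤ k) : 1 / (t : ℝ) ^ k ≤ 1 / 96 :=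
  (dle (T1 hl ht) zero_le_one le_rfl hk).trans
    (by rw [pow_one]; exact one_div_le_one_div_of_le (by norm_num) (T96 hl ht))

/-- Trading one power of `t` for a factor `1/96`. -/
theorem shrink {a : ℝ} (ha : 0 ≤ a) {j k : ℕ} (h : j + 1 ≤ k) : a / (t : ℝ) ^ k ≤ (a / 96) / (t : ℝ) ^ j := by
  have h1 := T1 hl ht
  have hT := Tpos hl ht
  calc a / (t : ℝ) ^ k ≤ a / (t : ℝ) ^ (j + 1) := dle h1 ha le_rfl h
    _ = (a / t) / (t : ℝ) ^ j := by rw [pow_succ, mul_comm, ← div_div]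
    _ ≤ (a / 96) / (t : ℝ) ^ j := by
        refine div_le_div_of_nonneg_right ?_ (pow_pos hT j).le
        exact div_le_div_of_nonneg_left ha (by norm_num) (T96 hl ht)

/-- `δs ≤ 2 / t³²`. -/
theorem δs_le : (bpar l t).δs ≤ 2 / (t : ℝ) ^ 32 := by
  have h1 := T1 hl ht
  simp only [Params.δs, r_eq, T_eq, u_eq]
  -- `2·(4/5)/t³² + 2·(2 t⁴ l²)·(4/5)/t⁴⁰`
  have e1 : 2 * (4 / 5 / (t : ℝ) ^ 32) = (8 / 5) / (t : ℝ) ^ 32 := by ring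
  have e2 : 2 * (2 * (t : ℝ) ^ 4 * (l : ℝ) ^ 2) * (4 / 5 / (t : ℝ) ^ 40) =
      (t : ℝ) ^ 4 * ((16 / 5 * (l : ℝ) ^ 2) / (t : ℝ) ^ (4 + 36)) := by ring
  rw [e1, e2, pmul h1]
  have h3 : (16 / 5 * (l : ℝ) ^ 2) / (t : ℝ) ^ 36 ≤ (2 / 15) / (t : ℝ) ^ 35 := by
    have : (16 / 5 * (l : ℝ) ^ 2) / (t : ℝ) ^ 36 = ((16 / 5 * (l : ℝ) ^ 2) / t) / (t : ℝ) ^ 35 := by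
      rw [div_div, ← pow_succ']
    rw [this]
    refine div_le_div_of_nonneg_right ?_ (pow_pos (Tpos hl ht) _).le
    rw [div_le_iff₀ (Tpos hl ht)]
    have := L2_le ht; nlinarith
  have h4 : (2 / 15) / (t : ℝ) ^ 35 ≤ (2 / 15) / (t : ℝ) ^ 32 := dle h1 (by norm_num) le_rfl (by norm_num)
  rw [show (2 : ℝ) / (t : ℝ) ^ 32 = (8 / 5) / (t : ℝ) ^ 32 + (2 / 5) / (t : ℝ) ^ 32 by rw [dadd]; norm_num]
  have h5 : (2 / 15 : ℝ) / (t : ℝ) ^ 32 ≤ (2 / 5) / (t : ℝ) ^ 32 := dle h1 (by norm_num) (by norm_num) le_rfl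
  linarith

/-- `δs_nn` (technical, see the section header). [folklore] -/
theorem δs_nn : 0 ≤ (bpar l t).δs := by
  have := Tpos hl ht
  simp only [Params.δs, r_eq, T_eq, u_eq]; positivity

/-! Bounds on the derived constants (`T = t ≥ 96`). -/

/-- `αp_bd` (technical, see the section header). [folklore] -/
theorem αp_bd : (bpar l t).αs ≤ (bpar l t).αp ∧ (bpar l t).αp ≤ 101 / (t : ℝ) ^ 32 := by
  have h1 := T1 hl ht
  have hT := Tpos hl ht
  have e : 4 * (4 / 5 / (t : ℝ) ^ 40) / (t : ℝ) ^ 3 = (16 / 5) / (t : ℝ) ^ 43 := by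
    field_simp; ring
  show 100 / (t : ℝ) ^ 32 ≤ 100 / (t : ℝ) ^ 32 + 4 * (4 / 5 / (t : ℝ) ^ 40) / (t : ℝ) ^ 3 ∧
    100 / (t : ℝ) ^ 32 + 4 * (4 / 5 / (t : ℝ) ^ 40) / (t : ℝ) ^ 3 ≤ 101 / (t : ℝ) ^ 32
  rw [e]
  have h0 : 0 ≤ (16 / 5 : ℝ) / (t : ℝ) ^ 43 := by positivity
  have h2 : (16 / 5 : ℝ) / (t : ℝ) ^ 43 ≤ 1 / (t : ℝ) ^ 32 :=
    (shrink hl ht (by norm_num) (by norm_num : 32 + 1 ≤ 43)).trans (dle h1 (by norm_num) (by norm_num) le_rfl)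
  have h3 : (101 : ℝ) / (t : ℝ) ^ 32 = 100 / (t : ℝ) ^ 32 + 1 / (t : ℝ) ^ 32 := by rw [dadd]; norm_num
  constructor <;> linarith

/-- `ps_bd` (technical, see the section header). [folklore] -/
theorem ps_bd : 0 ≤ (bpar l t).ps ∧ (bpar l t).ps ≤ 103 / (t : ℝ) ^ 32 := by
  have hT := Tpos hl ht
  obtain ⟨ha1, ha2⟩ := αp_bd hl ht
  have hαs : 0 ≤ (bpar l t).αs := by rw [αs_eq]; positivity
  have hδ := δs_le hl ht
  have hδ0 := δs_nn hl ht
  simp only [Params.ps, s_eq, one_mul]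
  constructor
  · linarith
  · rw [show (103 : ℝ) / (t : ℝ) ^ 32 = 101 / (t : ℝ) ^ 32 + 2 / (t : ℝ) ^ 32 by rw [dadd]; norm_num]
    linarith

/-- `ps_sq_le` (technical, see the section header). [folklore] -/
theorem ps_sq_le : (bpar l t).ps ^ 2 ≤ 10609 / (t : ℝ) ^ 64 := by
  obtain ⟨h0, h1⟩ := ps_bd hl ht
  calc (bpar l t).ps ^ 2 ≤ (103 / (t : ℝ) ^ 32) ^ 2 := pow_le_pow_left₀ h0 h1 2
    _ = 10609 / (t : ℝ) ^ 64 := by rw [div_pow, ← pow_mul]; norm_num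

/-- `ps²/ε ≤ 1/t⁴⁸` and `ps²/ε² ≤ 1/t⁴⁸`. -/
theorem x_bd : (bpar l t).ps ^ 2 / (bpar l t).ε ≤ 1 / (t : ℝ) ^ 48 ∧
    (bpar l t).ps ^ 2 / (bpar l t).ε ^ 2 ≤ 1 / (t : ℝ) ^ 48 ∧ 0 ≤ (bpar l t).ps ^ 2 / (bpar l t).ε ^ 2 := by
  have h1 := T1 hl ht
  have hT := Tpos hl ht
  have hps := ps_sq_le hl ht
  have h96 := T96 hl ht
  -- `16577 / t^64 ≤ 1 / t^48` since `t^16 ≥ 96^2 · t^14 ≥ 16577`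
  have key : (16577 : ℝ) / (t : ℝ) ^ 64 ≤ 1 / (t : ℝ) ^ 48 := by
    rw [div_le_div_iff₀ (by positivity) (by positivity), one_mul,
      show (t : ℝ) ^ 64 = (t : ℝ) ^ 48 * ((t : ℝ) ^ 3 * (t : ℝ) ^ 13) by ring]
    have ht3 : (96 : ℝ) ^ 3 ≤ (t : ℝ) ^ 3 := pow_le_pow_left₀ (by norm_num) h96 3
    have ht13 : (1 : ℝ) ≤ (t : ℝ) ^ 13 := one_le_pow₀ h1
    have h48 : (0 : ℝ) < (t : ℝ) ^ 48 := by positivity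
    have h16 : (16577 : ℝ) ≤ (t : ℝ) ^ 3 * (t : ℝ) ^ 13 := by nlinarith
    nlinarith
  simp only [ε_eq]
  refine ⟨?_, ?_, by positivity⟩
  · calc (bpar l t).ps ^ 2 / (4 / 5) = (5 / 4) * (bpar l t).ps ^ 2 := by ring
      _ ≤ (5 / 4) * (10609 / (t : ℝ) ^ 64) := by nlinarith
      _ ≤ 16577 / (t : ℝ) ^ 64 := by rw [← mul_div_assoc]; exact div_le_div_of_nonneg_right (by norm_num) (by positivity)
      _ ≤ _ := key
  · calc (bpar l t).ps ^ 2 / (4 / 5) ^ 2 = (25 / 16) * (bpar l t).ps ^ 2 := by ring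
      _ ≤ (25 / 16) * (10609 / (t : ℝ) ^ 64) := by nlinarith
      _ ≤ 16577 / (t : ℝ) ^ 64 := by rw [← mul_div_assoc]; exact div_le_div_of_nonneg_right (by norm_num) (by positivity)
      _ ≤ _ := key

/-- `νs_bd` (technical, see the section header). [folklore] -/
theorem νs_bd : 0 ≤ (bpar l t).νs ∧ (bpar l t).νs ≤ 3 / (t : ℝ) ^ 32 := by
  have h1 := T1 hl ht
  have hT := Tpos hl ht
  obtain ⟨hx, -, -⟩ := x_bd hl ht
  have hδ := δs_le hl ht
  have hδ0 := δs_nn hl ht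
  have hps0 : 0 ≤ (bpar l t).ps ^ 2 / (bpar l t).ε := by rw [ε_eq]; positivity
  simp only [Params.νs]
  constructor
  · linarith
  · have : (1 : ℝ) / (t : ℝ) ^ 48 ≤ 1 / (t : ℝ) ^ 32 := dle h1 zero_le_one le_rfl (by norm_num)
    rw [show (3 : ℝ) / (t : ℝ) ^ 32 = 2 / (t : ℝ) ^ 32 + 1 / (t : ℝ) ^ 32 by rw [dadd]; norm_num]
    linarith

/-- `dV_bd` (technical, see the section header). [folklore] -/
theorem dV_bd : 0 ≤ (bpar l t).dV ∧ (bpar l t).dV ≤ 4 / (t : ℝ) ^ 40 := by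
  have h1 := T1 hl ht
  have hT := Tpos hl ht
  obtain ⟨-, hx, hx0⟩ := x_bd hl ht
  simp only [Params.dV, u_eq, V_eq]
  constructor
  · positivity
  · have e1 : 2 * (4 / 5 / (t : ℝ) ^ 40) = (8 / 5) / (t : ℝ) ^ 40 := by ring
    have e2 : 2 * (t : ℝ) ^ 3 * ((bpar l t).ps ^ 2 / (bpar l t).ε ^ 2) ≤ 2 / (t : ℝ) ^ 45 := by
      calc 2 * (t : ℝ) ^ 3 * ((bpar l t).ps ^ 2 / (bpar l t).ε ^ 2) ≤ 2 * (t : ℝ) ^ 3 * (1 / (t : ℝ) ^ 48) := by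
            refine mul_le_mul_of_nonneg_left hx (by positivity)
        _ = 2 * ((t : ℝ) ^ 3 * (1 / (t : ℝ) ^ (3 + 45))) := by ring
        _ = 2 / (t : ℝ) ^ 45 := by rw [pmul h1]; ring
    have e3 : (2 : ℝ) / (t : ℝ) ^ 45 ≤ 2 / (t : ℝ) ^ 40 := dle h1 (by norm_num) le_rfl (by norm_num)
    rw [e1, show (4 : ℝ) / (t : ℝ) ^ 40 = (8 / 5) / (t : ℝ) ^ 40 + (12 / 5) / (t : ℝ) ^ 40 by rw [dadd]; norm_num]
    have e4 : (2 : ℝ) / (t : ℝ) ^ 40 ≤ (12 / 5) / (t : ℝ) ^ 40 := dle h1 (by norm_num) (by norm_num) le_rfl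
    linarith

/-- `KdV_bd` (technical, see the section header). [folklore] -/
theorem KdV_bd : 0 ≤ ((bpar l t).K : ℝ) * (bpar l t).dV ∧ ((bpar l t).K : ℝ) * (bpar l t).dV ≤ 9 / (t : ℝ) ^ 32 := by
  have h1 := T1 hl ht
  have hT := Tpos hl ht
  obtain ⟨hd0, hd⟩ := dV_bd hl ht
  rw [K_cast]
  constructor
  · positivity
  · have hl2 := TL ht
    calc (6 * (t : ℝ) ^ 7 * (l : ℝ) ^ 2 + 2) * (bpar l t).dV
        ≤ (6 * (t : ℝ) ^ 7 * (l : ℝ) ^ 2 + 2) * (4 / (t : ℝ) ^ 40) := mul_le_mul_of_nonneg_left hd (by positivity)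
      _ = (t : ℝ) ^ 7 * ((24 * (l : ℝ) ^ 2) / (t : ℝ) ^ (7 + 33)) + 8 / (t : ℝ) ^ 40 := by ring
      _ = (24 * (l : ℝ) ^ 2) / (t : ℝ) ^ 33 + 8 / (t : ℝ) ^ 40 := by rw [pmul h1]
      _ ≤ (t : ℝ) / (t : ℝ) ^ 33 + 8 / (t : ℝ) ^ 32 := by
          have := dle h1 (by norm_num : (0:ℝ) ≤ 8) le_rfl (by norm_num : 32 ≤ 40) (T := (t : ℝ))
          have := div_le_div_of_nonneg_right hl2 (pow_pos hT 33).le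
          linarith
      _ = 1 / (t : ℝ) ^ 32 + 8 / (t : ℝ) ^ 32 := by
          congr 1
          rw [show (t : ℝ) ^ 33 = (t : ℝ) ^ 1 * (t : ℝ) ^ 32 by ring, pow_one]
          field_simp
      _ = 9 / (t : ℝ) ^ 32 := by rw [dadd]; norm_num

/-- `u_bd` (technical, see the section header). [folklore] -/
theorem u_bd : 0 ≤ (bpar l t).u ∧ (bpar l t).u ≤ 1 / (t : ℝ) ^ 40 := by
  have h1 := T1 hl ht; have hT := Tpos hl ht
  rw [u_eq]; exact ⟨by positivity, dle h1 (by norm_num) (by norm_num) le_rfl⟩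

/-- `V_bd` (technical, see the section header). [folklore] -/
theorem V_bd : (bpar l t).Vlo ≤ (t : ℝ) ^ 3 ∧ (t : ℝ) ^ 3 - 1 ≤ (bpar l t).Vlo ∧
    (t : ℝ) ^ 3 ≤ (bpar l t).Vhi ∧ (bpar l t).Vhi ≤ (t : ℝ) ^ 3 + 1 := by
  have h1 := T1 hl ht; have hT := Tpos hl ht
  obtain ⟨hk0, hk⟩ := KdV_bd hl ht
  obtain ⟨hu0, hu⟩ := u_bd hl ht
  have hs1 : (9 : ℝ) / (t : ℝ) ^ 32 ≤ 9 / 96 := by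
    have := small hl ht (by norm_num : 1 ≤ 32); have e : (9 : ℝ) / (t : ℝ) ^ 32 = 9 * (1 / (t : ℝ) ^ 32) := by ring
    rw [e]; linarith
  have hs2 : (1 : ℝ) / (t : ℝ) ^ 40 ≤ 1 / 96 := small hl ht (by norm_num)
  simp only [Params.Vlo, Params.Vhi, V_eq]
  refine ⟨by linarith, by linarith, by linarith, by linarith⟩

/-- `T3` (technical, see the section header). [folklore] -/
theorem T3 : (96 : ℝ) ^ 3 ≤ (t : ℝ) ^ 3 := pow_le_pow_left₀ (by norm_num) (T96 hl ht) 3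
/-- `T2` (technical, see the section header). [folklore] -/
theorem T2 : (96 : ℝ) ^ 2 ≤ (t : ℝ) ^ 2 := pow_le_pow_left₀ (by norm_num) (T96 hl ht) 2

/-- `θhi ≤ (1/5 + 1/t²)/t³` and `θlo ≥ (1/5 - 1/t²)/t³`, `0 < θlo ≤ θhi`. -/
theorem θ_bd : (bpar l t).θhi ≤ (1 / 5 + 1 / (t : ℝ) ^ 2) / (t : ℝ) ^ 3 ∧
    (1 / 5 - 1 / (t : ℝ) ^ 2) / (t : ℝ) ^ 3 ≤ (bpar l t).θlo ∧ 0 < (bpar l t).θlo ∧ (bpar l t).θlo ≤ (bpar l t).θhi := by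
  have h1 := T1 hl ht; have hT := Tpos hl ht
  obtain ⟨hVlo1, hVlo2, hVhi1, hVhi2⟩ := V_bd hl ht
  obtain ⟨hν0, hν⟩ := νs_bd hl ht
  have hg := g_eq l t
  have ht3 := T3 hl ht
  have ht2 := T2 hl ht
  have hVlo0 : 0 < (bpar l t).Vlo := by nlinarith
  have hVhi0 : 0 < (bpar l t).Vhi := by nlinarith
  have hsm32 : (3 : ℝ) / (t : ℝ) ^ 32 ≤ (1 / 2) / (t : ℝ) ^ 2 :=
    (shrink hl ht (by norm_num) (by norm_num : 2 + 1 ≤ 32)).trans (dle h1 (by norm_num) (by norm_num) le_rfl)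
  have ht2i : (1 : ℝ) / (t : ℝ) ^ 2 ≤ 1 / 96 := small hl ht (by norm_num)
  have hp2 : (0 : ℝ) < 1 / (t : ℝ) ^ 2 := by positivity
  simp only [Params.θhi, Params.θlo, hg]
  refine ⟨?_, ?_, ?_, ?_⟩
  · rw [div_le_div_iff₀ hVlo0 (by positivity)]
    -- `(1/5 + νs) t³ ≤ (1/5 + 1/t²) Vlo`, using `Vlo ≥ t³ - 1`
    have h0 : (1 / 5 + 1 / (t : ℝ) ^ 2) * ((t : ℝ) ^ 3 - 1) ≤ (1 / 5 + 1 / (t : ℝ) ^ 2) * (bpar l t).Vlo :=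
      mul_le_mul_of_nonneg_left hVlo2 (by positivity)
    have e : (1 : ℝ) / (t : ℝ) ^ 2 * (t : ℝ) ^ 3 = t := by field_simp
    have ex : (1 / 5 + 1 / (t : ℝ) ^ 2) * ((t : ℝ) ^ 3 - 1) = (t : ℝ) ^ 3 / 5 + t - 1 / 5 - 1 / (t : ℝ) ^ 2 := by
      linear_combination e
    have hνt : (bpar l t).νs * (t : ℝ) ^ 3 ≤ 3 / (t : ℝ) ^ 29 := by
      calc (bpar l t).νs * (t : ℝ) ^ 3 ≤ 3 / (t : ℝ) ^ 32 * (t : ℝ) ^ 3 := mul_le_mul_of_nonneg_right hν (by positivity)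
        _ = 3 / (t : ℝ) ^ 29 := by rw [mul_comm, show (32 : ℕ) = 3 + 29 from rfl, pmul h1]
    have h29 : (3 : ℝ) / (t : ℝ) ^ 29 ≤ 3 / 96 := by
      have := small hl ht (by norm_num : 1 ≤ 29)
      have : (3 : ℝ) / (t : ℝ) ^ 29 = 3 * (1 / (t : ℝ) ^ 29) := by ring
      linarith
    have eg : (1 / 5 + (bpar l t).νs) * (t : ℝ) ^ 3 = (t : ℝ) ^ 3 / 5 + (bpar l t).νs * (t : ℝ) ^ 3 := by ring
    have h96 := T96 hl ht
    linarith
  · rw [div_le_div_iff₀ (by positivity) hVhi0]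
    have h0 : (1 / 5 - 1 / (t : ℝ) ^ 2) * (bpar l t).Vhi ≤ (1 / 5 - 1 / (t : ℝ) ^ 2) * ((t : ℝ) ^ 3 + 1) :=
      mul_le_mul_of_nonneg_left hVhi2 (by linarith)
    have e : (1 : ℝ) / (t : ℝ) ^ 2 * (t : ℝ) ^ 3 = t := by field_simp
    have ex : (1 / 5 - 1 / (t : ℝ) ^ 2) * ((t : ℝ) ^ 3 + 1) = (t : ℝ) ^ 3 / 5 - t + 1 / 5 - 1 / (t : ℝ) ^ 2 := by
      linear_combination -e
    have hνt : (bpar l t).νs * (t : ℝ) ^ 3 ≤ 3 / (t : ℝ) ^ 29 := by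
      calc (bpar l t).νs * (t : ℝ) ^ 3 ≤ 3 / (t : ℝ) ^ 32 * (t : ℝ) ^ 3 := mul_le_mul_of_nonneg_right hν (by positivity)
        _ = 3 / (t : ℝ) ^ 29 := by rw [mul_comm, show (32 : ℕ) = 3 + 29 from rfl, pmul h1]
    have h29 : (3 : ℝ) / (t : ℝ) ^ 29 ≤ 3 / 96 := by
      have := small hl ht (by norm_num : 1 ≤ 29)
      have : (3 : ℝ) / (t : ℝ) ^ 29 = 3 * (1 / (t : ℝ) ^ 29) := by ring
      linarith
    have eg : (1 / 5 - (bpar l t).νs) * (t : ℝ) ^ 3 = (t : ℝ) ^ 3 / 5 - (bpar l t).νs * (t : ℝ) ^ 3 := by ring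
    have h96 := T96 hl ht
    have hν3 : 0 ≤ (bpar l t).νs * (t : ℝ) ^ 3 := by positivity
    linarith
  · apply div_pos _ hVhi0
    have : (3 : ℝ) / (t : ℝ) ^ 32 ≤ 3 / 96 := by
      have := small hl ht (by norm_num : 1 ≤ 32)
      have e : (3 : ℝ) / (t : ℝ) ^ 32 = 3 * (1 / (t : ℝ) ^ 32) := by ring
      linarith
    linarith
  · -- `θlo ≤ θhi`
    rw [div_le_div_iff₀ hVhi0 hVlo0]
    have hνg : (bpar l t).νs ≤ 1 / 5 := by
      have := small hl ht (by norm_num : 1 ≤ 32)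
      have e : (3 : ℝ) / (t : ℝ) ^ 32 = 3 * (1 / (t : ℝ) ^ 32) := by ring
      linarith
    nlinarith


end bpar

end BasePar

end EquilibriumClampedCollisionalWindowLDNegative

end Summit.AtomisticToContinuum.HydrodynamicLimit.Theorems

end
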